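import Mathlib
import Summits.MatrixMultiplication.MatrixMultiplication.Theorems.SoloInformedCwTwoMonomialDoor
import Summits.MatrixMultiplication.MatrixMultiplication.Theorems.SoloInformedCwTwoBorderSumFree
import Summits.MatrixMultiplication.MatrixMultiplication.Theorems.SoloInformedCwTwoValueWeights

/-!
# Every pairing of binary positions is a weighted digit design of `S_N` (cost `σ + 1 = 4^N`)

Solo-informed seat, door D6/D7. The classical base-`4` digits `(0,1,2)·4^k` realising `T_{cw,2}^{⊠N}`
(`≅ X^{⊠N}` over `ℂ`) inside `ℤ/4^N` use the binary positions `{2k, 2k+1}` for the `k`-th factor. This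
file proves that ANY pairing works: for every bijection `e : Fin N ⊕ Fin N ≃ Fin m` (so `m = 2N`) the
integer digits `F k = (0, 2^{e(inl k)}, 2^{e(inr k)})` with indicator weights `θ k = (0,1,1)` form an
integer weighted digit design of `S_N` (`pairing_isDoorDesign`), of cost
`σ = ∑ₖ (F k 1 + F k 2) = 2^m − 1` (`pairingDigits_sigma`). The proof is a carry count: a relation
`P(u)+P(v)+P(w) = 2^m − 1` reads `∑_i n_i 2^i = 2^m − 1` where `n_i` is the number of letters among
`u, v, w` occupying bit `i`, and the total weight is `∑_i n_i`; the CARRY LEMMA (`carry_lemma`: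
`∑_{i<m} n_i 2^i + t = 2^m − 1 ⟹ ∑ n_i + t ≥ m`, with equality only if every `n_i = 1`) gives weight
`≥ m = h₀`, and equality forces both bits of every block to be occupied exactly once, i.e. the triple
is transversal. With the seat's value-weight lemma this yields `(2N)!/(2^N N!)` distinct weighted digit
designs of `S_N` in `ℤ/4^N`; the seat's exact census shows that for `N ≤ 3` these are ALL the integer
designs of minimal cost (`σ_min(N) = 4^N − 1`).

References: D. Coppersmith, S. Winograd, *Matrix multiplication via arithmetic progressions*,
JSC 9 (1990), §6; J. Alman, V. Vassilevska Williams, *Limits on all known (and some unknown)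
approaches to matrix multiplication*, FOCS 2018, arXiv:1810.08671, Thm 7.2; E. Kummer (1852),
carries in binary addition (the carry lemma is the three-summand form of Kummer's count).
-/

open scoped BigOperators

namespace Summit.MatrixMultiplication.MatrixMultiplication.Theorems

open Literature.Computability.AlgebraicComplexity

/-! ## The carry lemma -/

/-- **Carry lemma.** If `∑_{i<m} n i · 2^i + t = 2^m − 1` with natural `n i, t`, then
`m ≤ ∑_{i<m} n i + t`, and if equality holds then `n 0 + t = 1` (when `m > 0`) and `n i = 1` for
`0 < i < m`. (Induction on `m`: `n 0 + t` is odd, `= 2t' + 1`, and `t'` is the carry into bit `1`.)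
[folklore; Kummer 1852] -/
theorem carry_lemma : ∀ (m : ℕ) (n : ℕ → ℕ) (t : ℕ),
    (∑ i ∈ Finset.range m, n i * 2 ^ i) + t = 2 ^ m - 1 →
      m ≤ (∑ i ∈ Finset.range m, n i) + t ∧
        ((∑ i ∈ Finset.range m, n i) + t ≤ m →
          (0 < m → n 0 + t = 1) ∧ ∀ i, 0 < i → i < m → n i = 1) := by
  intro m
  induction m with
  | zero =>
    intro n t h
    simp only [Finset.range_zero, Finset.sum_empty, zero_add, pow_zero,
      Nat.sub_self] at h
    subst h
    simp
  | succ m ih =>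
    intro n t h
    rw [Finset.sum_range_succ'] at h
    simp only [pow_zero, mul_one] at h
    have h2 : ∑ i ∈ Finset.range m, n (i + 1) * 2 ^ (i + 1) =
        2 * ∑ i ∈ Finset.range m, n (i + 1) * 2 ^ i := by
      rw [Finset.mul_sum]
      refine Finset.sum_congr rfl fun i _ => ?_
      rw [pow_succ]; ring
    rw [h2] at h
    have hpow : 2 ^ (m + 1) = 2 * 2 ^ m := by rw [pow_succ]; ring
    have hpos : 0 < 2 ^ m := by positivity
    set A := ∑ i ∈ Finset.range m, n (i + 1) * 2 ^ i with hA
    set t' := (n 0 + t) / 2 with ht'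
    have hodd : n 0 + t = 2 * t' + 1 := by omega
    have hA' : A + t' = 2 ^ m - 1 := by omega
    obtain ⟨ih1, ih2⟩ := ih (fun i => n (i + 1)) t' hA'
    have hsplit : ∑ i ∈ Finset.range (m + 1), n i = (∑ i ∈ Finset.range m, n (i + 1)) + n 0 :=
      Finset.sum_range_succ' n m
    refine ⟨by omega, fun hle => ?_⟩
    have ht'0 : t' = 0 := by omega
    have hle' : (∑ i ∈ Finset.range m, n (i + 1)) + t' ≤ m := by omega
    obtain ⟨ih3, ih4⟩ := ih2 hle'
    refine ⟨fun _ => by omega, fun i hi him => ?_⟩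
    obtain ⟨j, rfl⟩ : ∃ j, i = j + 1 := ⟨i - 1, by omega⟩
    rcases Nat.eq_zero_or_pos j with hj | hj
    · subst hj
      have := ih3 (by omega)
      simpa [ht'0] using this
    · exact ih4 j hj (by omega)

/-! ## Pairing digit systems -/

variable {N m : ℕ}

/-- The digits of a pairing `e`: `F k = (0, 2^{e(inl k)}, 2^{e(inr k)})`. [new; seat solo-informed] -/
def pairingDigits (e : Fin N ⊕ Fin N ≃ Fin m) : Fin N → Fin 3 → ℕ :=
  fun k j => if j = 1 then 2 ^ (e (Sum.inl k) : ℕ) else if j = 2 then 2 ^ (e (Sum.inr k) : ℕ) else 0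

/-- Indicator weights `θ k = (0,1,1)` (weight `1` on every nonzero digit). [new; seat solo-informed] -/
def indicatorWeights : Fin N → Fin 3 → ℕ := fun _ j => if j = 0 then 0 else 1

/-- Occupancy of a binary position (named by its block and side) by a word `u`:
`inl k ↦ [u k = 1]`, `inr k ↦ [u k = 2]`. [new; seat solo-informed] -/
def occ (u : Fin N → Fin 3) : Fin N ⊕ Fin N → ℕ :=
  Sum.elim (fun k => if u k = 1 then 1 else 0) (fun k => if u k = 2 then 1 else 0)

/-- A digit is the occupancy-weighted sum of its block's two powers of two. [folklore] -/
theorem pairingDigits_apply (e : Fin N ⊕ Fin N ≃ Fin m) (u : Fin N → Fin 3) (k : Fin N) :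
    pairingDigits e k (u k) =
      occ u (Sum.inl k) * 2 ^ (e (Sum.inl k) : ℕ) + occ u (Sum.inr k) * 2 ^ (e (Sum.inr k) : ℕ) := by
  have h3 : ∀ x : Fin 3, x = 0 ∨ x = 1 ∨ x = 2 := by decide
  rcases h3 (u k) with h | h | h <;> simp [pairingDigits, occ, h]

/-- An indicator weight is the total occupancy of the block. [folklore] -/
theorem indicatorWeights_apply (u : Fin N → Fin 3) (k : Fin N) :
    indicatorWeights k (u k) = occ u (Sum.inl k) + occ u (Sum.inr k) := by
  have h3 : ∀ x : Fin 3, x = 0 ∨ x = 1 ∨ x = 2 := by decide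
  rcases h3 (u k) with h | h | h <;> simp [indicatorWeights, occ, h]

/-- The natural word sum of a pairing system, read off bit by bit. [folklore] -/
theorem pairing_wordSum_nat (e : Fin N ⊕ Fin N ≃ Fin m) (u : Fin N → Fin 3) :
    ∑ k, pairingDigits e k (u k) = ∑ i : Fin m, occ u (e.symm i) * 2 ^ (i : ℕ) := by
  simp_rw [pairingDigits_apply]
  rw [Finset.sum_add_distrib]
  have h := e.symm.sum_comp (fun s => occ u s * 2 ^ (e s : ℕ))
  simp only [Equiv.apply_symm_apply] at h
  rw [h, Fintype.sum_sum_type]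

/-- The word weight of a pairing system is the number of occupied bits. [folklore] -/
theorem pairing_wordWt (e : Fin N ⊕ Fin N ≃ Fin m) (u : Fin N → Fin 3) :
    wordWt indicatorWeights u = ∑ i : Fin m, occ u (e.symm i) := by
  unfold wordWt
  simp_rw [indicatorWeights_apply]
  rw [Finset.sum_add_distrib]
  have h := e.symm.sum_comp (fun s => occ u s)
  rw [h, Fintype.sum_sum_type]

/-- `∑_{i<m} 2^i = 2^m − 1`. [folklore] -/
theorem sum_two_pow_eq (m : ℕ) : ∑ i ∈ Finset.range m, 2 ^ i = 2 ^ m - 1 := by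
  induction m with
  | zero => simp
  | succ m ih =>
    rw [Finset.sum_range_succ, ih, pow_succ]
    have : 0 < 2 ^ m := by positivity
    omega

/-- The cost of a pairing system: `σ = ∑ₖ (F k 0 + F k 1 + F k 2) = 2^m − 1`. [new; seat solo-informed] -/
theorem pairingDigits_sigma (e : Fin N ⊕ Fin N ≃ Fin m) :
    ∑ k, (pairingDigits e k 0 + pairingDigits e k 1 + pairingDigits e k 2) = 2 ^ m - 1 := by
  have h1 : ∀ k, pairingDigits e k 0 + pairingDigits e k 1 + pairingDigits e k 2 =
      2 ^ (e (Sum.inl k) : ℕ) + 2 ^ (e (Sum.inr k) : ℕ) := by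
    intro k; simp [pairingDigits]
  simp_rw [h1]
  rw [Finset.sum_add_distrib]
  have h := e.symm.sum_comp (fun s => 2 ^ (e s : ℕ))
  simp only [Equiv.apply_symm_apply] at h
  rw [← Fintype.sum_sum_type (f := fun s => 2 ^ (e s : ℕ)), ← h,
    Fin.sum_univ_eq_sum_range (fun i => 2 ^ i) m, sum_two_pow_eq]

/-- A pairing covers `m = 2N` positions. [folklore] -/
theorem pairing_card (e : Fin N ⊕ Fin N ≃ Fin m) : m = N + N := by
  have h := Fintype.card_congr e
  simp only [Fintype.card_sum, Fintype.card_fin] at h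
  omega

/-- If both bits of a block are occupied exactly once among `u, v, w`, the block is transversal. [folklore] -/
theorem distinct_of_counts (a b c : Fin 3)
    (h1 : (if a = 1 then 1 else 0) + (if b = 1 then 1 else 0) + (if c = 1 then 1 else 0) = (1 : ℕ))
    (h2 : (if a = 2 then 1 else 0) + (if b = 2 then 1 else 0) + (if c = 2 then 1 else 0) = (1 : ℕ)) :
    a ≠ b ∧ a ≠ c ∧ b ≠ c := by
  revert a b c; decide

/-- **Pairing theorem.** For every pairing `e` of `2N` binary positions into `N` blocks, the digits
`(0, 2^{e(inl k)}, 2^{e(inr k)})` with indicator weights are an integer weighted digit design of `S_N`: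
every integer relation `P(u)+P(v)+P(w) = σ = 2^m − 1` off `S_N` has total weight `> 2N`.
[new; seat solo-informed, door D7] -/
theorem pairing_isDoorDesign (e : Fin N ⊕ Fin N ≃ Fin m) :
    IsDoorDesign (fun k j => (pairingDigits e k j : ℤ)) indicatorWeights := by
  intro u v w hrel
  -- the relation in `ℕ`
  have hrelN : (∑ k, pairingDigits e k (u k)) + (∑ k, pairingDigits e k (v k)) +
      (∑ k, pairingDigits e k (w k)) = 2 ^ m - 1 := by
    rw [← pairingDigits_sigma e]
    simp only [wordSum] at hrel
    exact_mod_cast hrel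
  rw [pairing_wordSum_nat, pairing_wordSum_nat, pairing_wordSum_nat] at hrelN
  -- bit occupancies
  set nn : Fin m → ℕ := fun i => occ u (e.symm i) + occ v (e.symm i) + occ w (e.symm i) with hnn
  let n' : ℕ → ℕ := fun j => if h : j < m then nn ⟨j, h⟩ else 0
  have hn'val : ∀ i : Fin m, n' i = nn i := fun i => by simp [n', i.is_lt]
  have hsumpow : ∑ j ∈ Finset.range m, n' j * 2 ^ j = 2 ^ m - 1 := by
    rw [← Fin.sum_univ_eq_sum_range (fun j => n' j * 2 ^ j) m]
    simp only [hn'val, hnn]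
    rw [← hrelN]
    simp only [add_mul, Finset.sum_add_distrib]
  have hwt : wordWt indicatorWeights u + wordWt indicatorWeights v + wordWt indicatorWeights w =
      ∑ j ∈ Finset.range m, n' j := by
    rw [← Fin.sum_univ_eq_sum_range (fun j => n' j) m]
    simp only [hn'val, hnn, pairing_wordWt e, Finset.sum_add_distrib]
  have hh0 : ∑ k : Fin N, (indicatorWeights (N := N) k 0 + indicatorWeights k 1 + indicatorWeights k 2)
      = N + N := by
    simp [indicatorWeights, Finset.sum_const, Finset.card_univ, Fintype.card_fin]; ring
  have hm : m = N + N := pairing_card e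
  obtain ⟨hge, heq⟩ := carry_lemma m n' 0 (by simpa using hsumpow)
  rw [hh0]
  by_cases hlt : N + N < wordWt indicatorWeights u + wordWt indicatorWeights v + wordWt indicatorWeights w
  · exact Or.inr hlt
  · left
    have hle : (∑ j ∈ Finset.range m, n' j) + 0 ≤ m := by omega
    obtain ⟨h0, hrest⟩ := heq hle
    have hall : ∀ i : Fin m, nn i = 1 := by
      intro i
      rw [← hn'val]
      rcases Nat.eq_zero_or_pos (i : ℕ) with hi | hi
      · have := h0 (by omega)
        rw [hi]; simpa using this
      · exact hrest i hi i.is_lt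
    intro k
    have h1 := hall (e (Sum.inl k))
    have h2 := hall (e (Sum.inr k))
    simp only [hnn, Equiv.symm_apply_apply, occ, Sum.elim_inl, Sum.elim_inr] at h1 h2
    exact distinct_of_counts (u k) (v k) (w k) h1 h2

/-- **Corollary: `bR(T_{cw,2}^{⊠N}) ≤ 2^m = 4^N` through EVERY pairing** — `(2N)!/(2^N·N!)` distinct
monomial degenerations `T_{ℤ/4^N} ⊵ T_{cw,2}^{⊠N}` (value weights, `SoloInformedCwTwoValueWeights`).
[new; seat solo-informed, door D7] -/
theorem algBorderRank_kroneckerPow_cwTensor_two_le_of_pairing (e : Fin N ⊕ Fin N ≃ Fin m) :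
    algBorderRank (kroneckerPow (cwTensor ℂ 2) N) ≤ 2 ^ m := by
  have h := algBorderRank_kroneckerPow_cwTensor_two_le_sigma_succ (pairingDigits e) indicatorWeights
    (pairing_isDoorDesign e)
  have hσ : digitSigma (pairingDigits e) = 2 ^ m - 1 := pairingDigits_sigma e
  have h1 : 1 ≤ 2 ^ m := Nat.one_le_two_pow
  have h2 : 2 ^ m - 1 + 1 = 2 ^ m := by omega
  rwa [hσ, h2] at h

end Summit.MatrixMultiplication.MatrixMultiplication.Theorems
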